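import Summits.Ventures.HodgeRepro2.T5CyclotomicSevenHeckeCommutative
import Summits.Ventures.HodgeRepro2.T5RecordSatakeSevenDegreeOne

/-!
# THE SATAKE CHAIN OF THE RECORD'S PAIR AT EVERY INERT PLACE OF THE FIELD OF RECORD, WITH `q = p^{gcd(o, 3)}` EXPLICIT

Tier-5 support N3 / §G-N4.2 (seat p3, gen 79). Files 257 (`o = 6`, `q = p³`) and 265 (`o = 2`, `q = p`) read the
Satake chain of the record's own pair at the inert places of `ℚ(ζ₇)⁺` one residue class at a time. With the census
of file 266 (`N(v) = p^{gcd(o, 3)}`, `v` stays prime iff `o := orderOf (p mod 7)` is even) the chain reads uniformly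
at EVERY place `v` of `ℚ(ζ₇)⁺` above a prime `p ≠ 7` of even order modulo `7` — i.e. at every place above a quadratic
non-residue modulo `7` — with the residue cardinality `q = N(v) = p^{gcd(o, 3)}` explicit in `p`:

* **`exists_doubleCosetOp_aeval_bijective_and_ncard_record_seven_of_even`** — the generator `T₁ = 1_{K_v g₀ K_v}` of
  `H(U(1 ⊗ H₀), K_v) ≃ k[T₁]` has `deg T₁ = p^{4 gcd(o,3)} + p^{gcd(o,3)} = q⁴ + q`;
* **`exists_cells_ncard_and_three_term_record_seven_of_even`** — cells `gₙ` with `deg Tₙ = (q³ + 1) q^{4n−3}`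
  (`n ≥ 1`), `deg T₀ = 1`, `T₁ T_{n+2} = T_{n+3} + (q − 1) T_{n+2} + q⁴ T_{n+1}`, `T₁² = T₂ + (q − 1) T₁ + (q⁴ + q) T₀`
  (`k` of characteristic `0`), `q = p^{gcd(o,3)}`;
* **`exists_doubleCosetOp_aeval_bijective_and_ncard_record_seven_of_not_isSquare`** — the same with the hypothesis
  «`p` is a quadratic non-residue modulo `7`».

§8(d): uses an L-value-free non-vanishing device: NO.
-/

open Matrix NumberField NumberField.IsCMField IsDedekindDomain IsDedekindDomain.HeightOneSpectrum Module Polynomial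
  MulAction
open scoped TensorProduct Pointwise
open Summit.Ventures.HodgeRepro2.T5UnitaryGroupForm Summit.Ventures.HodgeRepro2.T5UnitaryHeckeAdjoint
  Summit.Ventures.HodgeRepro2.T5HeckePermutationModule Summit.Ventures.HodgeRepro2.T5HeckeDoubleCoset
  Summit.Ventures.HodgeRepro2.T5RecordHyperspecial Summit.Ventures.HodgeRepro2.T5GlobalLatticeAlmostAll
  Summit.Ventures.HodgeRepro2.T5FinitePlaceSplitClassification Summit.Ventures.HodgeRepro2.T5RecordSatakeIntrinsic
  Summit.Ventures.HodgeRepro2.T5CMFieldSquareDatum Summit.Ventures.HodgeRepro2.T5RecordSatakeToy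
  Summit.Ventures.HodgeRepro2.T5RecordSatakeDegreeIntrinsic
  Summit.Ventures.HodgeRepro2.T5RecordSatakeRecurrenceIntrinsic
  Summit.Ventures.HodgeRepro2.T5SplitPlaceUnitaryGroup Summit.Ventures.HodgeRepro2.T5NonSplitPlaceUnitaryGroup
  Summit.Ventures.HodgeRepro2.T5FinitePlaceCM Summit.Ventures.HodgeRepro2.T5StarOfInvolution
  Summit.Ventures.HodgeRepro2.T5RecordSatake Summit.Ventures.HodgeRepro2.T5RecordSatakeInert
  Summit.Ventures.HodgeRepro2.T5RecordSatakeCell Summit.Ventures.HodgeRepro2.T5RecordSatakeDegree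
  Summit.Ventures.HodgeRepro2.T5RecordSatakeRecurrence Summit.Ventures.HodgeRepro2.T5RecordSatakeInertToyDegree
  Summit.Ventures.HodgeRepro2.T5RecordSatakeDegreeCells Summit.Ventures.HodgeRepro2.T5CyclotomicSevenInertThree
  Summit.Ventures.HodgeRepro2.T5CyclotomicSevenInertPrime Summit.Ventures.HodgeRepro2.T5CyclotomicSevenDegreeOnePrime
  Summit.Ventures.HodgeRepro2.T5CyclotomicSevenPlaceCensus Summit.Ventures.HodgeRepro2.T5CyclotomicSevenHeckeCommutative

namespace Summit.Ventures.HodgeRepro2.T5RecordSatakeSevenCensus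

section Record

variable (K : Type*) [Field K] [CharZero K] [IsCyclotomicExtension {7} ℚ K]
variable (p : ℕ) [hp : Fact p.Prime] (h7 : ¬ p ∣ 7)
variable (v : HeightOneSpectrum (𝓞 (maximalRealSubfield K))) [hv : v.asIdeal.LiesOver (Ideal.span {(p : ℤ)})]
include hv h7

/-- **`deg T₁ = q⁴ + q` WITH `q = p^{gcd(o,3)}` AT EVERY INERT PLACE OF `ℚ(ζ₇)`** (file 245's datum-free generator
with `(N(v)³ + 1) · N(v)` and file 266's `N(v) = p^{gcd(o,3)}`): for every prime `p ≠ 7` of even order `o` modulo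
`7`, every place `v` of `ℚ(ζ₇)⁺` above `p`, every family `l` of generators of `𝓞_{ℚ(ζ₇)}` over `𝓞_{ℚ(ζ₇)⁺}` and every
field `k`, some `g₀ ∈ U(1 ⊗ H₀)` has a double coset of exactly `p^{4 gcd(o,3)} + p^{gcd(o,3)}` left cosets whose
characteristic function `T₁` generates `H(U(1 ⊗ H₀), K_v)`. -/
theorem exists_doubleCosetOp_aeval_bijective_and_ncard_record_seven_of_even (heven : Even (orderOf (p : ZMod 7)))
    (k : Type*) [Field k] {r : ℕ} (l : Fin r → 𝓞 K)
    (hl : Submodule.span (𝓞 (maximalRealSubfield K)) (Set.range l) = ⊤) :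
    haveI := numberField' K; haveI := isCMField' K
    ∃ g₀ : (letI := tensorStarRing K v; ↥(formUnitaryGroup (tensorGram K v (gramToy K)))),
      (orbit (recordHyperspecial K v l (gramToy K))
        (g₀ : _ ⧸ recordHyperspecial K v l (gramToy K))).ncard =
          p ^ (4 * Nat.gcd (orderOf (p : ZMod 7)) 3) + p ^ Nat.gcd (orderOf (p : ZMod 7)) 3 ∧
      ∃ _ : Finite (orbit (recordHyperspecial K v l (gramToy K))
          (g₀ : _ ⧸ recordHyperspecial K v l (gramToy K))),
        Function.Bijective (aeval (doubleCosetOp k (recordHyperspecial K v l (gramToy K)) g₀) :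
          k[X] →ₐ[k] heckeAlgebra k (recordHyperspecial K v l (gramToy K))) := by
  haveI := numberField' K
  haveI := isCMField' K
  refine ((exists_map_eq_iff_even K p h7 v).mpr heven).elim fun w hmap => ?_
  have key := @exists_doubleCosetOp_aeval_bijective_and_ncard_record_of_staysPrime K _ (numberField' K)
    (isCMField' K) v w (liesOver_of_map_eq K v w hmap) hmap _ l k _ hl _ gramToy_isHermitian isUnit_det_gramToy
    (notMem_badSet_gramToy _)
  obtain ⟨g₀, hn, hb⟩ := key
  exact ⟨g₀, hn.trans (by rw [absNorm_eq_pow_gcd K p h7 v, ← pow_mul]; ring), hb⟩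

/-- **THE DEGREES OF ALL THE CELLS AND THE TREE RECURSION AT EVERY INERT PLACE OF `ℚ(ζ₇)`, `q = p^{gcd(o,3)}`**
(file 251's datum-free theorem with `N(v) = p^{gcd(o,3)}`): cells `gₙ ∈ U(1 ⊗ H₀)` with
`#(K_v gₙ K_v / K_v) = (q³ + 1) q^{4n−3}` (`n ≥ 1`), `#(K_v g₀ K_v / K_v) = 1`, and `Tₙ := 1_{K_v gₙ K_v}` satisfying
`T₁ T_{n+2} = T_{n+3} + (q − 1) T_{n+2} + q⁴ T_{n+1}` and `T₁² = T₂ + (q − 1) T₁ + (q⁴ + q) T₀`. -/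
theorem exists_cells_ncard_and_three_term_record_seven_of_even (heven : Even (orderOf (p : ZMod 7)))
    (k : Type*) [Field k] [CharZero k] {r : ℕ} (l : Fin r → 𝓞 K)
    (hl : Submodule.span (𝓞 (maximalRealSubfield K)) (Set.range l) = ⊤) :
    haveI := numberField' K; haveI := isCMField' K
    ∃ g : ℕ → (letI := tensorStarRing K v; ↥(formUnitaryGroup (tensorGram K v (gramToy K)))),
      (∀ n, 1 ≤ n → (orbit (recordHyperspecial K v l (gramToy K))
        (g n : _ ⧸ recordHyperspecial K v l (gramToy K))).ncard =
          ((p ^ Nat.gcd (orderOf (p : ZMod 7)) 3) ^ 3 + 1) * (p ^ Nat.gcd (orderOf (p : ZMod 7)) 3) ^ (4 * n - 3)) ∧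
      (orbit (recordHyperspecial K v l (gramToy K))
        (g 0 : _ ⧸ recordHyperspecial K v l (gramToy K))).ncard = 1 ∧
      ∃ hfin : ∀ n, Finite (orbit (recordHyperspecial K v l (gramToy K))
          (g n : _ ⧸ recordHyperspecial K v l (gramToy K))),
        (∀ n, letI := hfin 1; letI := hfin (n + 1 + 1); letI := hfin (n + 1 + 1 + 1); letI := hfin (n + 1);
          doubleCosetOp k (recordHyperspecial K v l (gramToy K)) (g 1) *
              doubleCosetOp k (recordHyperspecial K v l (gramToy K)) (g (n + 1 + 1)) =
            doubleCosetOp k (recordHyperspecial K v l (gramToy K)) (g (n + 1 + 1 + 1)) +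
              ((p : k) ^ Nat.gcd (orderOf (p : ZMod 7)) 3 - 1) •
                doubleCosetOp k (recordHyperspecial K v l (gramToy K)) (g (n + 1 + 1)) +
              ((p : k) ^ Nat.gcd (orderOf (p : ZMod 7)) 3) ^ 4 •
                doubleCosetOp k (recordHyperspecial K v l (gramToy K)) (g (n + 1))) ∧
        (letI := hfin 1; letI := hfin (0 + 1); letI := hfin (0 + 1 + 1); letI := hfin 0;
          doubleCosetOp k (recordHyperspecial K v l (gramToy K)) (g 1) *
              doubleCosetOp k (recordHyperspecial K v l (gramToy K)) (g (0 + 1)) =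
            doubleCosetOp k (recordHyperspecial K v l (gramToy K)) (g (0 + 1 + 1)) +
              ((p : k) ^ Nat.gcd (orderOf (p : ZMod 7)) 3 - 1) •
                doubleCosetOp k (recordHyperspecial K v l (gramToy K)) (g (0 + 1)) +
              (((p : k) ^ Nat.gcd (orderOf (p : ZMod 7)) 3) ^ 4 + (p : k) ^ Nat.gcd (orderOf (p : ZMod 7)) 3) •
                doubleCosetOp k (recordHyperspecial K v l (gramToy K)) (g 0)) := by
  haveI := numberField' K
  haveI := isCMField' K
  refine ((exists_map_eq_iff_even K p h7 v).mpr heven).elim fun w hmap => ?_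
  have e1 : ((Ideal.absNorm v.asIdeal : k) - 1) = (p : k) ^ Nat.gcd (orderOf (p : ZMod 7)) 3 - 1 := by
    rw [absNorm_eq_pow_gcd K p h7 v, Nat.cast_pow]
  have e2 : (Ideal.absNorm v.asIdeal : k) ^ 4 = ((p : k) ^ Nat.gcd (orderOf (p : ZMod 7)) 3) ^ 4 := by
    rw [absNorm_eq_pow_gcd K p h7 v, Nat.cast_pow]
  have e3 : (Ideal.absNorm v.asIdeal : k) ^ 4 + Ideal.absNorm v.asIdeal =
      ((p : k) ^ Nat.gcd (orderOf (p : ZMod 7)) 3) ^ 4 + (p : k) ^ Nat.gcd (orderOf (p : ZMod 7)) 3 := by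
    rw [absNorm_eq_pow_gcd K p h7 v, Nat.cast_pow]
  have key := @exists_cells_three_term_and_ncard_record_of_staysPrime' K _ (numberField' K) (isCMField' K)
    v w (liesOver_of_map_eq K v w hmap) hmap _ l k _ _ hl _ gramToy_isHermitian isUnit_det_gramToy
    (notMem_badSet_gramToy _)
  obtain ⟨g, hdeg, hdeg0, hfin, h1, h2'⟩ := key
  exact ⟨g, fun n hn => (hdeg n hn).trans (by rw [absNorm_eq_pow_gcd K p h7 v]), hdeg0, hfin,
    fun n => three_term_congr e1 e2 (h1 n), three_term_congr e1 e3 h2'⟩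

/-- **`deg T₁ = q⁴ + q` AT EVERY PLACE OF `ℚ(ζ₇)⁺` ABOVE A QUADRATIC NON-RESIDUE `p` MODULO `7`** — the
quadratic-residue form of the generator's degree (`o` is even iff `p` is a non-square modulo `7`, file 266). -/
theorem exists_doubleCosetOp_aeval_bijective_and_ncard_record_seven_of_not_isSquare
    (hns : ¬ IsSquare (p : ZMod 7)) (k : Type*) [Field k] {r : ℕ} (l : Fin r → 𝓞 K)
    (hl : Submodule.span (𝓞 (maximalRealSubfield K)) (Set.range l) = ⊤) :
    haveI := numberField' K; haveI := isCMField' K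
    ∃ g₀ : (letI := tensorStarRing K v; ↥(formUnitaryGroup (tensorGram K v (gramToy K)))),
      (orbit (recordHyperspecial K v l (gramToy K))
        (g₀ : _ ⧸ recordHyperspecial K v l (gramToy K))).ncard =
          p ^ (4 * Nat.gcd (orderOf (p : ZMod 7)) 3) + p ^ Nat.gcd (orderOf (p : ZMod 7)) 3 ∧
      ∃ _ : Finite (orbit (recordHyperspecial K v l (gramToy K))
          (g₀ : _ ⧸ recordHyperspecial K v l (gramToy K))),
        Function.Bijective (aeval (doubleCosetOp k (recordHyperspecial K v l (gramToy K)) g₀) :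
          k[X] →ₐ[k] heckeAlgebra k (recordHyperspecial K v l (gramToy K))) :=
  exists_doubleCosetOp_aeval_bijective_and_ncard_record_seven_of_even K p h7 v
    (Nat.not_odd_iff_even.mp ((isSquare_iff_odd_orderOf (p : ZMod 7) (natCast_ne_zero_zmod_seven p h7)).not.mp hns))
    k l hl

end Record

end Summit.Ventures.HodgeRepro2.T5RecordSatakeSevenCensus
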